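import Summits.HodgeConjecture.CorCM.Model.GysinRational
import Summits.HodgeConjecture.CorCM.KunnethDegreeOne
import HarnessLib

/-!
# COR-CM model layer, towards fact F7 `Fact_gysin` (row Fg7): the block Gysin map `p_{Y*}` of a pair of
# «block projections» `p_Y : P ⟶ Y`, `p_{Y'} : P ⟶ Y'`, with algebraicity and the projection formula

Cell `pub-hodgecm2` (COR-CM), seat `b25` (binder prover for row Fg7 of `BINDER-OWNERS.md` = stage-1 fact F7
`Fact_gysin`, `HodgeCM/StubTree/Qw8GeometricBlocks.lean` l.234), building on seat `model-1`'s parts 6a/6b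
(`CorCM/Model/GysinRational`, `CorCM/Model/KunnethTopClass`; plan `FG7-GYSIN-PLAN.md` (e)+(g)).

For smooth projective `P`, `Y`, `Y'` over `ℂ` of dimensions `d_A + d_B`, `d_A`, `d_B` and morphisms
`p_A : P ⟶ Y`, `p_B : P ⟶ Y'` such that `p_A^* e ∪ p_B^* ω ≠ 0` for SOME top classes `e ∈ H^{2d_A}(Y; ℚ)`,
`ω ∈ H^{2d_B}(Y'; ℚ)` (the cohomological trace of «`(p_A, p_B)` is the product decomposition»), the maps

  `gy k := s₀⁻¹ • (p_A)_! : H^{k + 2 d_B}(P; ℚ) → H^k(Y; ℚ)`  (`k ≤ 2 d_A`; `0` above the top degree),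

`(p_A)_!` the rational Gysin map for the rational complex orientations (`complexOrientationRat`, `gysinMap`),
satisfy (`exists_blockGysin`):

* (i) they send classes `z` whose complexification lies in `N^{p + d_B} H^{2p + 2d_B}(P; ℂ)` to rational
  algebraic classes of codimension `p` on `Y` (complex Gysin maps preserve the coniveau,
  `complexGysin_mem_supportedClasses`; rational vs complex Gysin `complexGysin_ringChange_eq_smul_gysinMap`);
* (ii) the projection formula with base change `gy k (p_A^* e ∪ p_B^* ω) = tr_{Y'}(ω) • e` for ALL `e ∈ H^k(Y; ℚ)`,
  `ω ∈ H^{2d_B}(Y'; ℚ)` — from Fulton's projection formula `(p_A)_!(p_A^* e ∪ y) = e ∪ (p_A)_! y`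
  (`gysinMap_map_cupProduct`), `(p_A)_!(p_B^* ω) ∈ H⁰(Y; ℚ) = ℚ · 1` (`singularCohomology.eq_smul_one`), the fact that
  `ω ↦ ε((p_A)_! p_B^* ω)` and the light trace `tr_{Y'}` (`BettiUniverse.tr`) are two functionals on the top LINE
  `H^{2d_B}(Y'; ℚ)` (`finrank_rat_top`), hence proportional with ratio `s₀`, and `s₀ ≠ 0` because `(p_A)_!` is
  injective in top degree (`gysinMap_top_eq_zero`) and `p_A^* e ∪ p_B^* ω ≠ 0` for the given pair.

All degrees are carried as variables with equations (the style of the tree's Gysin formalism), so that the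
instantiation at the model universe's `2 * (p + d_B)` vs `2 * p + 2 * d_B` needs no transport inside this file.
Print shape: Fulton, *Intersection Theory* §19.1 Lemma 19.1.2, Example 8.1.7 / Prop. 8.3 (c); Voisin I §7.3.2.
-/

noncomputable section

open CategoryTheory
open Literature.AlgebraicTopology.SingularHomology
open Literature.AlgebraicGeometry.Motives (SchemeOver ComplexPoints IsSmoothProjective bettiCohomology bettiCup)
open Literature.AlgebraicGeometry.HodgeTheory
open Literature.NumberTheory.Automorphic.PicardCM

namespace Summit.HodgeConjecture.CorCM.Model

section General

variable {m n : ℕ} {Y X : SchemeOver ℂ}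

/-- Top-degree injectivity of the rational Gysin map, degrees as variables: for `f : Y ⟶ X`, `a = 2 dim Y`,
`b = 2 dim X` (`q = 0`), `f_! w = 0 → w = 0` (`gysinMap_top_eq_zero`). -/
theorem gysinMap_eq_zero_of_top (hY : IsSmoothProjective m Y) (hX : IsSmoothProjective n X) (f : Y ⟶ X)
    {a b q : ℕ} (hq : q = 0) (ha : a + q = 2 * m) (hb : b + q = 2 * n) {w : bettiCohomology Y a}
    (hw : gysinMap (complexOrientationRat hY) (complexOrientationRat hX)
      (Literature.AlgebraicGeometry.Motives.AlgPoints.mapContinuous (L := ℂ) f) ha hb w = 0) : w = 0 := by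
  subst hq
  obtain rfl : a = 2 * m := by omega
  obtain rfl : b = 2 * n := by omega
  exact gysinMap_top_eq_zero hY hX f hw

/-- **Rational Gysin maps preserve the coniveau, degrees as variables**: for `f : Y ⟶ X` (`dim Y = m`,
`dim X = n`), `a + q = 2m`, `b + q = 2n`, `s + m ≤ n + r`, a class `z ∈ Hᵃ(Y; ℚ)` whose complexification lies in
`Nʳ Hᵃ(Y; ℂ)` is sent by `f_!` to a class whose complexification lies in `Nˢ Hᵇ(X; ℂ)`
(`complexGysin_mem_supportedClasses`, `complexGysin_ringChange_eq_smul_gysinMap`). -/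
theorem ofRatClass_gysinMap_mem_supportedClasses (hY : IsSmoothProjective m Y) (hX : IsSmoothProjective n X)
    (f : Y ⟶ X) {a b q r s : ℕ} (ha : a + q = 2 * m) (hb : b + q = 2 * n) (hrs : s + m ≤ n + r)
    {z : bettiCohomology Y a} (hz : ofRatClass (ComplexPoints Y) a z ∈ supportedClasses Y a r) :
    ofRatClass (ComplexPoints X) b
        (gysinMap (complexOrientationRat hY) (complexOrientationRat hX)
          (Literature.AlgebraicGeometry.Motives.AlgPoints.mapContinuous (L := ℂ) f) ha hb z) ∈
      supportedClasses X b s := by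
  rw [ofRatClass_eq_ringChange] at hz ⊢
  obtain ⟨u, hu, hug⟩ := complexGysin_ringChange_eq_smul_gysinMap (μ := complexOrientationFamily)
    hasPoincareDuality_complexOrientationFamily hY hX f ha hb
    (complexOrientationRat hY) (complexOrientationRat hX) (hasPoincareDuality_complexOrientationRat hX)
  have h1 : singularCohomology.ringChange (algebraMap ℚ ℂ) (ComplexPoints X) b
        (gysinMap (complexOrientationRat hY) (complexOrientationRat hX)
          (Literature.AlgebraicGeometry.Motives.AlgPoints.mapContinuous (L := ℂ) f) ha hb z) =
      u⁻¹ • complexGysin complexOrientationFamily hY hX f (show a + 2 * n = b + 2 * m by omega)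
        (singularCohomology.ringChange (algebraMap ℚ ℂ) (ComplexPoints Y) a z) := by
    rw [hug, smul_smul, inv_mul_cancel₀ hu, one_smul]
  rw [h1]
  exact Submodule.smul_mem _ _
    (complexGysin_mem_supportedClasses (gysinMap_restrictCompl_eq_zero_of_field ℂ) complexOrientationFamily
      hasPoincareDuality_complexOrientationFamily hY hX f _ hrs hz)

end General

/-! ### The block Gysin map -/

section Block

variable {dP dA dB : ℕ} {P Y Y' : SchemeOver ℂ}

/-- **The block Gysin map of `(p_A, p_B)`** (fact F7 `Fact_gysin` on tree objects).  For `P`, `Y`, `Y'` smooth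
projective of dimensions `d_A + d_B`, `d_A`, `d_B`, morphisms `p_A : P ⟶ Y`, `p_B : P ⟶ Y'` with `p_A^* e ∪ p_B^* ω ≠ 0`
for some top classes `e`, `ω`, there are `ℚ`-linear maps `gy k : H^{k + 2d_B}(P; ℚ) → H^k(Y; ℚ)` (`k ∈ ℕ`) which
(i) send every class whose complexification is supported in codimension `p + d_B` to a rational algebraic class
of codimension `p`, and (ii) satisfy the projection formula with base change
`gy k (p_A^* e ∪ p_B^* ω) = tr_{Y'}(ω) • e` for all `e ∈ H^k(Y; ℚ)`, `ω ∈ H^{2d_B}(Y'; ℚ)`. -/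
theorem exists_blockGysin (hP : IsSmoothProjective dP P) (hY : IsSmoothProjective dA Y)
    (hY' : IsSmoothProjective dB Y') (hd : dP = dA + dB) (pA : P ⟶ Y) (pB : P ⟶ Y')
    (hne : ∃ (t : ℕ) (ht : 2 * dA + 2 * dB = t) (e : bettiCohomology Y (2 * dA)) (ω : bettiCohomology Y' (2 * dB)),
      bettiCup ht (BettiUniverse.pull pA (2 * dA) e) (BettiUniverse.pull pB (2 * dB) ω) ≠ 0) :
    ∃ gy : (k : ℕ) → (bettiCohomology P (k + 2 * dB) →ₗ[ℚ] bettiCohomology Y k),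
      (∀ (p : ℕ) (z : bettiCohomology P (2 * p + 2 * dB)),
          ofRatClass (ComplexPoints P) (2 * p + 2 * dB) z ∈ supportedClasses P (2 * p + 2 * dB) (p + dB) →
          gy (2 * p) z ∈ ratAlgebraicClasses Y p) ∧
      (∀ (k : ℕ) (e : bettiCohomology Y k) (ω : bettiCohomology Y' (2 * dB)),
          gy k (BettiUniverse.cup P k (2 * dB) (BettiUniverse.pull pA k e) (BettiUniverse.pull pB (2 * dB) ω)) =
            BettiUniverse.tr hY' (2 * dB) ω • e) := by
  classical
  subst hd
  obtain ⟨t, ht, e₀, ω₀, hne⟩ := hne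
  subst ht
  haveI : PathConnectedSpace (ComplexPoints Y) := pathConnectedSpace_complexPoints hY
  -- notation
  set f := Literature.AlgebraicGeometry.Motives.AlgPoints.mapContinuous (L := ℂ) pA with hf
  set μP := complexOrientationRat hP with hμP
  set μY := complexOrientationRat hY with hμY
  have hPD : μY.HasPoincareDuality := hasPoincareDuality_complexOrientationRat hY
  -- the raw Gysin maps `G k = (p_A)_! : H^{k + 2 d_B}(P) → H^k(Y)` (`k ≤ 2 d_A`), and `g₀ : H^{2 d_B}(P) → H⁰(Y)`
  let G : (k : ℕ) → (bettiCohomology P (k + 2 * dB) →ₗ[ℚ] bettiCohomology Y k) := fun k =>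
    if h : k ≤ 2 * dA then
      gysinMap μP μY f (a := k + 2 * dB) (b := k) (q := 2 * dA - k) (by omega) (by omega)
    else 0
  have hG : ∀ (k : ℕ) (h : k ≤ 2 * dA),
      G k = gysinMap μP μY f (a := k + 2 * dB) (b := k) (q := 2 * dA - k) (by omega) (by omega) :=
    fun k h => dif_pos h
  have hG' : ∀ (k : ℕ), ¬ k ≤ 2 * dA → G k = 0 := fun k h => dif_neg h
  let g₀ : bettiCohomology P (2 * dB) →ₗ[ℚ] bettiCohomology Y 0 :=
    gysinMap μP μY f (a := 2 * dB) (b := 0) (q := 2 * dA) (by omega) (by omega)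
  -- projection formula: `G k (p_A^* e ∪ y) = e ∪ g₀ y`
  have hproj : ∀ (k : ℕ) (h : k ≤ 2 * dA) (e : bettiCohomology Y k) (y : bettiCohomology P (2 * dB)),
      G k (BettiUniverse.cup P k (2 * dB) (BettiUniverse.pull pA k e) y) =
        cupProduct (rfl : k + 0 = k) e (g₀ y) := by
    intro k h e y
    rw [hG k h]
    exact gysinMap_map_cupProduct (μY := μP) (μX := μY) hPD
      (show Even (2 * (dA + dB) + 2 * dA) from ⟨dA + dB + dA, by ring⟩) f
      (p := k) (a := 2 * dB) (s := k + 2 * dB) (q := 2 * dA - k) (t := k) (k := 2 * dA) (b := 0)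
      rfl (by omega) (by omega) (by omega) (by omega) (by omega) rfl e y
  -- `g₀ y ∈ H⁰(Y; ℚ) = ℚ · 1`: the functional `φ = ε ∘ g₀ ∘ p_B^*` on `H^{2 d_B}(Y'; ℚ)`
  let φ : bettiCohomology Y' (2 * dB) →ₗ[ℚ] ℚ :=
    (singularCohomologyZeroEquiv ℚ ℚ (ComplexPoints Y)).toLinearMap ∘ₗ g₀ ∘ₗ BettiUniverse.pull pB (2 * dB)
  have hφ : ∀ (k : ℕ) (h : k ≤ 2 * dA) (e : bettiCohomology Y k) (ω : bettiCohomology Y' (2 * dB)),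
      G k (BettiUniverse.cup P k (2 * dB) (BettiUniverse.pull pA k e) (BettiUniverse.pull pB (2 * dB) ω)) =
        φ ω • e := by
    intro k h e ω
    rw [hproj k h e, singularCohomology.eq_smul_one ℚ (g₀ (BettiUniverse.pull pB (2 * dB) ω)),
      LinearMap.map_smul, cupProduct_one' (R := ℚ)]
    rfl
  -- `φ = s₀ • tr_{Y'}` on the top line of `Y'`
  have h1Y' : Module.finrank ℚ (bettiCohomology Y' (2 * dB)) = 1 := finrank_rat_top hY'
  obtain ⟨s₀, hs₀⟩ := exists_eq_smul_of_finrank_eq_one' h1Y' φ (BettiUniverse.tr hY' (2 * dB))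
    (BettiUniverse.tr_ne_zero hY' h1Y')
  -- `s₀ ≠ 0`: otherwise `G (2 d_A)` kills `p_A^* e₀ ∪ p_B^* ω₀ ≠ 0`, contradicting top-degree injectivity
  have hs₀0 : s₀ ≠ 0 := by
    rintro rfl
    rw [zero_smul] at hs₀
    have h0 : G (2 * dA) (BettiUniverse.cup P (2 * dA) (2 * dB) (BettiUniverse.pull pA (2 * dA) e₀)
        (BettiUniverse.pull pB (2 * dB) ω₀)) = 0 := by
      rw [hφ (2 * dA) le_rfl, hs₀, LinearMap.zero_apply, zero_smul]
    rw [hG (2 * dA) le_rfl] at h0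
    exact hne (gysinMap_eq_zero_of_top hP hY pA (q := 2 * dA - 2 * dA) (by omega) _ _ h0)
  -- the normalised maps
  refine ⟨fun k => s₀⁻¹ • G k, ?_, ?_⟩
  · intro p z hz
    by_cases h : 2 * p ≤ 2 * dA
    · rw [LinearMap.smul_apply, hG (2 * p) h]
      refine Submodule.smul_mem _ _ ?_
      rw [mem_ratAlgebraicClasses_iff]
      exact ofRatClass_gysinMap_mem_supportedClasses hP hY pA _ _ (by omega) hz
    · rw [LinearMap.smul_apply, hG' (2 * p) h, LinearMap.zero_apply, smul_zero]
      exact Submodule.zero_mem _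
  · intro k e ω
    by_cases h : k ≤ 2 * dA
    · rw [LinearMap.smul_apply, hφ k h, smul_smul]
      have hk := LinearMap.congr_fun hs₀ ω
      rw [LinearMap.smul_apply, smul_eq_mul] at hk
      rw [hk, ← mul_assoc, inv_mul_cancel₀ hs₀0, one_mul]
    · haveI : Subsingleton (bettiCohomology Y k) :=
        Literature.AlgebraicGeometry.Motives.ComplexPoints.subsingleton_singularCohomology_of_lt hY ℚ (by omega)
      exact Subsingleton.elim _ _

end Block

end Summit.HodgeConjecture.CorCM.Model

end
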